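import Summits.KontsevichZagierPeriods.Zeta5Search.LaiSweepShard

/-!
# `κ₃` sweep certificate — shard file 003 of 127 (shards 21–27 of 889)

HONEST FRAMING. Systematic search; no irrationality claim unless certified. This file only checks,
by `decide +kernel`, shards 21–27 of the order-cell sweep of the `κ₃` point `(74, 2180, 444; δ74)`
(engine `LaiSweepEngine`, soundness `LaiSweepJump/Free/Eval/Shard/Kappa3`; a shard is `⟨regime, n,
p, q, p', q', Lo, Up⟩`: `n` cells from `p/q` to `p'/q'` with integer rate sums in `[Lo, Up]`, `K =
128`, `D = 2^40`). It draws NO conclusion: only the capstone `LaiKappa3SweepCert`, which needs all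
127 shard files, does. Kernel cost of this file ≈ 560 cells × 0.3 s.
-/

namespace Summit.KontsevichZagierPeriods.Zeta5Search.Sweep

set_option maxHeartbeats 100000000 in
/-- Shard 21: 80 cells of regime A from `8/1111` to `19/2564`.
[cite: Lai2024BallRivoal, §4 Lemma 4.3] -/
theorem shard021 :
    Shard.check 128 (2^40)
      ⟨false, 80, 8, 1111, 19, 2564, 290737451175996, 290900408262881⟩ = true := by
  decide +kernel

set_option maxHeartbeats 100000000 in
/-- Shard 22: 80 cells of regime A from `19/2564` to `17/2222`.
[cite: Lai2024BallRivoal, §4 Lemma 4.3] -/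
theorem shard022 :
    Shard.check 128 (2^40)
      ⟨false, 80, 19, 2564, 17, 2222, 305286028708271, 305461566853909⟩ = true := by
  decide +kernel

set_option maxHeartbeats 100000000 in
/-- Shard 23: 80 cells of regime A from `17/2222` to `9/1145`.
[cite: Lai2024BallRivoal, §4 Lemma 4.3] -/
theorem shard023 :
    Shard.check 128 (2^40)
      ⟨false, 80, 17, 2222, 9, 1145, 249722602774144, 249842702315478⟩ = true := by
  decide +kernel

set_option maxHeartbeats 100000000 in
/-- Shard 24: 80 cells of regime A from `9/1145` to `9/1108`.
[cite: Lai2024BallRivoal, §4 Lemma 4.3] -/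
theorem shard024 :
    Shard.check 128 (2^40)
      ⟨false, 80, 9, 1145, 9, 1108, 292942035896899, 293110209868330⟩ = true := by
  decide +kernel

set_option maxHeartbeats 100000000 in
/-- Shard 25: 80 cells of regime A from `9/1108` to `7/835`.
[cite: Lai2024BallRivoal, §4 Lemma 4.3] -/
theorem shard025 :
    Shard.check 128 (2^40)
      ⟨false, 80, 9, 1108, 7, 835, 276051451862019, 276206698810987⟩ = true := by
  decide +kernel

set_option maxHeartbeats 100000000 in
/-- Shard 26: 80 cells of regime A from `7/835` to `19/2208`.
[cite: Lai2024BallRivoal, §4 Lemma 4.3] -/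
theorem shard026 :
    Shard.check 128 (2^40)
      ⟨false, 80, 7, 835, 19, 2208, 220358246156100, 220466904165465⟩ = true := by
  decide +kernel

set_option maxHeartbeats 100000000 in
/-- Shard 27: 80 cells of regime A from `19/2208` to `10/1133`.
[cite: Lai2024BallRivoal, §4 Lemma 4.3] -/
theorem shard027 :
    Shard.check 128 (2^40)
      ⟨false, 80, 19, 2208, 10, 1133, 210910287342657, 211009391846093⟩ = true := by
  decide +kernel

/-- The checked shards of this file, in order. [folklore] -/
def shards003 : List (CheckedShard 128 (2^40)) :=
  [⟨_, shard021⟩, ⟨_, shard022⟩, ⟨_, shard023⟩, ⟨_, shard024⟩, ⟨_, shard025⟩,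
    ⟨_, shard026⟩, ⟨_, shard027⟩]

end Summit.KontsevichZagierPeriods.Zeta5Search.Sweep
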